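import Literature.AnabelianGeometry.EtaleTheta.ThetaKummerInversionFixedPoints
import Literature.AnabelianGeometry.EtaleTheta.ThetaKummerInputOfCore
import Literature.AnabelianGeometry.EtaleTheta.CyclotomeHomQmodZ
import Literature.AnabelianGeometry.EtaleTheta.SettingModelChiOriginProfile
import Mathlib.Tactic.LinearCombination
import HarnessLib

/-!
# A theta-Kummer input with GENUINE constants AND the DECK identity of [EtTh] Prop 1.4 (ii) — from a Kummer core and
# a `χ`-crossed `y`-coordinate (the «`Ü`-monomial» function module); witnessed at the χ-twisted root model

S. Mochizuki, *The étale theta function …*, Publ. RIMS **45** (2009) [EtTh], Prop 1.4 (ii) p. 22 («`Θ̈(−Ü) = −Θ̈(Ü)`»),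
Prop 1.3 p. 21 (Kummer classes of constants), §1 p. 13 («`Ÿ → Y` … of degree 2», the coordinate `Ü`), Prop 1.5 (ii)
p. 23 («`log(Ü)`»; «any inversion automorphism ι … maps `log(Ü)` ↦ `−log(Ü)`»). Classical here.

abc-iut cell, layer L2, seat abc-iut-w5-d125 (gen 7); PROOF-ONLY (NO definition, NO `Prop` fact, NO instance — every
object is built inside the existence proof, as in this seat's `ThetaKummerInputOfCore.lean`; D-0067). NON-VACUITY
companion of `ThetaKummerInversionFixedPoints.lean` (p447891/p448600):

So far every `ThetaKummerInput` with GENUINE coefficients in the tree has a CONSTANT "`Θ̈`" (this seat's gen 3/6 files), on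
which the deck binder `hdeck : ε • Θ̈ = const(−1)·Θ̈` (ε ∈ Π^tp_Y ∖ Π^tp_Ÿ) is FALSE. THIS FILE builds, over any theta setting
`D` with a Kummer core `C` (abc-iut-w5-d171) and a continuous `χ`-CROSSED `y`-COORDINATE `y : Π^tp_X → Ẑ`
(`y(gh) = y(g)·χ(aug g)(y(h))`, even exactly on `Π^tp_Ÿ` inside `Π^tp_Y`), the MONOMIAL function module
`Fn := ℚ̄_pˣ × ℚ` («`c · Ü^r`»): `Π^tp_X` acts by `g • (c, r) := (aug(g)·c · exp_ξ(y(g)·r/2), r)`, where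
`exp_ξ(e · s) := toHom(e⁻¹-image of e)(s mod ℤ)` is the exponential attached to the discrete-logarithm isomorphism
`Λ(ℚ̄_pˣ) ≅ Ẑ` of the R78 files (`cycEquiv`, `cyclotome.toHom`); a 1-cocycle identity (`y` crossed, `cycEquiv` χ-equivariant)
makes this an action by automorphisms. With `Θ̈ := (1, 1)` («`Ü`»), roots `(1, 1/N)`, constants `(c, 0)`:

* `KummerCore.exists_thetaKummerInput_deck_of_yCocycle` — `∃ T : D.ThetaKummerInput` with BIJECTIVE coefficients,
  `T.ConstCompat C.toKummerData` (genuine Kummer classes of constants) AND the deck identity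
  `∀ ε ∈ Π^tp_Y ∖ Π^tp_Ÿ, ε • Θ̈ = const(−1)·Θ̈` (parity of `y(ε)` and `ξ_2 = −1`).
* `SettingModel.exists_thetaKummerInput_deck_modelχ` — the instance at abc-iut-L2-t1's `modelχ` with abc-iut-w5-d171's
  `kummerCoreχ` and `y := yCoordχ` (`yCoordχ_mul`, continuity, parity from `Δ^tp_{Y₂}`): **`hdeck` and genuine
  constants are JOINTLY WITNESSED** (census: was «DEGENERATE-only / constant Θ̈»).
* `SettingModel.exists_thetaKummerInput_deck_not_package_modelχ` — and, by `ThetaKummerInversionFixedPoints`, this very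
  witness admits NO function-level inversion package for the inversion of record (its `κ(Θ̈)` is the `y`-class `log(Ü)`,
  which print says the inversion NEGATES — the «`y`-class» exclusion of `kummerCocycle_mul_inversionRoot_eq`).

HONEST LABEL: the function module is the `Ü`-MONOMIAL module (its "`Θ̈`" is the coordinate `Ü`, whose deck behaviour
`Ü ↦ −Ü` is that of `Θ̈`); it is NOT the theta function (no `Θ̈(q^{a/2}Ü)` translate law, class = `log(Ü)` not `η̈^Θ`).
SEMI-SYNTHETIC at `modelχ`; consistency / independence evidence for the typed interface only; nothing of [EtTh] asserted;
no side taken on [IUTchIII] Cor 3.12.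
-/

noncomputable section

namespace Literature.AnabelianGeometry.EtaleTheta

open Literature.AnabelianGeometry.SemiGraphs Literature.IUT.HodgeArakelov

namespace ThetaSetting

namespace KummerCore

variable {p : ℕ} [Fact p.Prime] {D : ThetaSetting p} (C : D.KummerCore)

omit C in
/-- `-1 ≠ 1` in `ℚ̄_pˣ` (characteristic `0`). [cite: MochizukiEtTh2009, §1 p.17] -/
private theorem neg_one_ne_one_units_padicAlgCl : (-1 : (PadicAlgCl p)ˣ) ≠ 1 := by
  intro h
  have h1 : ((-1 : (PadicAlgCl p)ˣ) : PadicAlgCl p) = ((1 : (PadicAlgCl p)ˣ) : PadicAlgCl p) := by rw [h]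
  rw [Units.val_neg, Units.val_one] at h1
  haveI : CharZero (PadicAlgCl p) :=
    charZero_of_injective_algebraMap (algebraMap ℚ_[p] (PadicAlgCl p)).injective
  exact two_ne_zero (by linear_combination -h1 : (2 : PadicAlgCl p) = 0)

/-- **A theta-Kummer input with genuine constants AND the deck identity**, from a Kummer core `C` and a continuous
`χ`-crossed `y`-coordinate `y : Π^tp_X → Ẑ` that is EVEN exactly on `Π^tp_Ÿ` inside `Π^tp_Y`: the `Ü`-monomial module
`ℚ̄_pˣ × ℚ` with `g • (c, r) = (aug(g)·c · exp_ξ(y(g) r/2), r)`, `Θ̈ := (1,1)`. Conclusions: bijective coefficients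
`Λ(Fn) = Λ(ℚ̄_pˣ) ≅ Δ_Θ`, `ConstCompat C.toKummerData`, and `ε • Θ̈ = const(−1)·Θ̈` for every `ε ∈ Π^tp_Y ∖ Π^tp_Ÿ`.
[cite: MochizukiEtTh2009, Prop 1.4 (ii) p.22] -/
theorem exists_thetaKummerInput_deck_of_yCocycle (y : D.PiTemp → SettingModel.ZH)
    (hy_mul : ∀ g h : D.PiTemp, y (g * h) = y g * SettingModel.chi p (D.aug g) (y h))
    (hy_cont : Continuous y)
    (hy_even : ∀ g ∈ D.GtpYdd, ZHatLevel.level 2 (y g) = 1)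
    (hy_odd : ∀ g ∈ D.GtpY, g ∉ D.GtpYdd → ZHatLevel.level 2 (y g) ≠ 1) :
    ∃ T : D.ThetaKummerInput, Function.Bijective T.coeff.hom ∧ T.ConstCompat C.toKummerData ∧
      ∀ ε : D.PiTemp, ε ∈ D.GtpY → ε ∉ D.GtpYdd → ε • T.theta = T.const (-1) * T.theta := by
  classical
  -- `Π^tp_X` acts on `ℚ̄_pˣ` through `aug`
  letI instA : MulDistribMulAction D.PiTemp (PadicAlgCl p)ˣ :=
    MulDistribMulAction.compHom _ (D.aug.toMonoidHom : D.PiTemp →* GQp p)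
  have hsmulA : ∀ (g : D.PiTemp) (u : (PadicAlgCl p)ˣ), g • u = (D.aug.toMonoidHom g) • u := fun _ _ => rfl
  have hsmulA' : ∀ (g : D.PiTemp) (u : (PadicAlgCl p)ˣ), (D.aug g) • u = g • u := fun _ _ => rfl
  -- `y 1 = 1`
  have hy_one : y 1 = 1 := by
    have h := hy_mul 1 1
    rw [mul_one, map_one, map_one, MulAut.one_apply] at h
    exact mul_eq_left.mp h.symm
  /- the exponential `Φ e : ℚ → ℚ̄_pˣ`, `r ↦ toHom(e⁻¹(e))(r/2 mod ℤ)` -/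
  let halfQ : Multiplicative ℚ →* Multiplicative (AddCircle (1 : ℚ)) :=
    AddMonoidHom.toMultiplicative
      ((QuotientAddGroup.mk' (AddSubgroup.zmultiples (1 : ℚ))).comp (AddMonoidHom.mulLeft ((1 : ℚ) / 2)))
  have halfQ_apply : ∀ q : ℚ, halfQ (Multiplicative.ofAdd q) =
      Multiplicative.ofAdd ((((1 : ℚ) / 2 * q : ℚ) : AddCircle (1 : ℚ))) := fun _ => rfl
  let Φ : SettingModel.ZH → (Multiplicative ℚ →* (PadicAlgCl p)ˣ) := fun e =>
    (cyclotome.toHom ((SettingModel.cycEquiv p).symm e)).comp halfQ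
  have Φ_apply : ∀ e r, Φ e r = cyclotome.toHom ((SettingModel.cycEquiv p).symm e) (halfQ r) := fun _ _ => rfl
  have toHom_mul : ∀ (ζ ζ' : cyclotome (PadicAlgCl p)ˣ) (u : Multiplicative (AddCircle (1 : ℚ))),
      cyclotome.toHom (ζ * ζ') u = cyclotome.toHom ζ u * cyclotome.toHom ζ' u := by
    intro ζ ζ' u
    rw [← cyclotome.homQmodZEquiv_symm_apply, map_mul, MonoidHom.mul_apply,
      cyclotome.homQmodZEquiv_symm_apply, cyclotome.homQmodZEquiv_symm_apply]
  have Φ_mul : ∀ e e' r, Φ (e * e') r = Φ e r * Φ e' r := by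
    intro e e' r
    rw [Φ_apply, Φ_apply, Φ_apply, map_mul, toHom_mul]
  have Φ_one : ∀ r, Φ 1 r = 1 := by
    intro r
    have h := Φ_mul 1 1 r
    rw [one_mul] at h
    exact mul_eq_left.mp h.symm
  have symm_chi : ∀ (σ : GQp p) (e : SettingModel.ZH),
      (SettingModel.cycEquiv p).symm (SettingModel.chi p σ e) = σ • (SettingModel.cycEquiv p).symm e := by
    intro σ e
    apply (SettingModel.cycEquiv p).injective
    rw [MulEquiv.apply_symm_apply, SettingModel.cycEquiv_smul, MulEquiv.apply_symm_apply]
  have Φ_chi : ∀ (σ : GQp p) (e : SettingModel.ZH) (r : Multiplicative ℚ),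
      Φ (SettingModel.chi p σ e) r = σ • Φ e r := by
    intro σ e r
    rw [Φ_apply, Φ_apply, symm_chi, cyclotome.toHom_smul]
    rfl
  -- level-`2` values: `Φ e 1 = ξ_2 ^ (level₂ e)`
  have halfQ_one : halfQ (Multiplicative.ofAdd (1 : ℚ)) =
      Multiplicative.ofAdd ((((1 : ℚ) / ((2 : ℕ+) : ℕ) : ℚ) : AddCircle (1 : ℚ))) := by
    rw [halfQ_apply]; norm_num
  have Φ_at_one : ∀ e : SettingModel.ZH, Φ e (Multiplicative.ofAdd (1 : ℚ)) =
      (SettingModel.cycGen p : ℕ+ → (PadicAlgCl p)ˣ) 2 ^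
        (Multiplicative.toAdd (ZHatLevel.level 2 e)).val := by
    intro e
    rw [Φ_apply, halfQ_one, cyclotome.toHom_ofAdd_inv, ← SettingModel.cycGen_pow_level p _ 2,
      MulEquiv.apply_symm_apply]
  have cycGen_two : (SettingModel.cycGen p : ℕ+ → (PadicAlgCl p)ˣ) 2 = -1 := by
    have h := SettingModel.isPrimitiveRoot_coe_cycGen p 2
    apply Units.ext
    rw [Units.val_neg, Units.val_one]
    exact h.eq_neg_one_of_two_right
  have Φ_at_one_of_even : ∀ e : SettingModel.ZH, ZHatLevel.level 2 e = 1 →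
      Φ e (Multiplicative.ofAdd (1 : ℚ)) = 1 := by
    intro e he
    rw [Φ_at_one, he, toAdd_one, ZMod.val_zero, pow_zero]
  have Φ_at_one_of_odd : ∀ e : SettingModel.ZH, ZHatLevel.level 2 e ≠ 1 →
      Φ e (Multiplicative.ofAdd (1 : ℚ)) = -1 := by
    intro e he
    have hne : Multiplicative.toAdd (ZHatLevel.level 2 e) ≠ 0 := fun h0 =>
      he (by rw [← ofAdd_toAdd (ZHatLevel.level 2 e), h0, ofAdd_zero])
    have h1 : Multiplicative.toAdd (ZHatLevel.level 2 e) = 1 := by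
      have key : ∀ a : ZMod 2, a ≠ 0 → a = 1 := by decide
      exact key _ hne
    rw [Φ_at_one, h1, ZMod.val_one, pow_one, cycGen_two]
  -- general vanishing: `Φ e r = 1` whenever `level_M e = 1` for a suitable `M` (depending on `r`)
  have Φ_triv : ∀ r : Multiplicative ℚ, ∃ M : ℕ+, ∀ e : SettingModel.ZH, ZHatLevel.level M e = 1 → Φ e r = 1 := by
    intro r
    let q : ℚ := Multiplicative.toAdd r
    have hMpos : 0 < 2 * q.den := by positivity
    let M : ℕ+ := ⟨2 * q.den, hMpos⟩
    have hM : ((M : ℕ) : ℚ) = 2 * q.den := by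
      show (((2 * q.den : ℕ)) : ℚ) = 2 * q.den
      push_cast; ring
    refine ⟨M, fun e he => ?_⟩
    have hq : ((1 : ℚ) / 2 * q) = (q.num : ℚ) * ((1 : ℚ) / (M : ℕ)) := by
      rw [hM]
      have hden : (q.den : ℚ) ≠ 0 := Nat.cast_ne_zero.mpr q.den_nz
      have hq' : q = q.num / q.den := (Rat.num_div_den q).symm
      conv_lhs => rw [hq']
      field_simp
    have hu : halfQ r = (Multiplicative.ofAdd ((((1 : ℚ) / (M : ℕ) : ℚ) : AddCircle (1 : ℚ)))) ^ q.num := by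
      rw [show r = Multiplicative.ofAdd q from (ofAdd_toAdd r).symm, halfQ_apply, ← ofAdd_zsmul,
        ← AddCircle.coe_zsmul, zsmul_eq_mul, hq]
    rw [Φ_apply, hu, map_zpow, cyclotome.toHom_ofAdd_inv, ← SettingModel.cycGen_pow_level p _ _,
      MulEquiv.apply_symm_apply, he, toAdd_one, ZMod.val_zero, pow_zero, one_zpow]
  /- the monomial module `Fn := ℚ̄_pˣ × ℚ` -/
  letI iS : SMul D.PiTemp ((PadicAlgCl p)ˣ × Multiplicative ℚ) :=
    ⟨fun g f => (g • f.1 * Φ (y g) f.2, f.2)⟩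
  have smul_def : ∀ (g : D.PiTemp) (f : (PadicAlgCl p)ˣ × Multiplicative ℚ),
      g • f = (g • f.1 * Φ (y g) f.2, f.2) := fun _ _ => rfl
  letI instFn : MulDistribMulAction D.PiTemp ((PadicAlgCl p)ˣ × Multiplicative ℚ) :=
    { one_smul := fun f => Prod.ext (by
        change (1 : D.PiTemp) • f.1 * Φ (y 1) f.2 = f.1
        rw [one_smul, hy_one, Φ_one, mul_one]) rfl
      mul_smul := fun g h f => Prod.ext (by
        change (g * h) • f.1 * Φ (y (g * h)) f.2 = g • (h • f.1 * Φ (y h) f.2) * Φ (y g) f.2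
        rw [hy_mul, Φ_mul, Φ_chi, hsmulA', mul_smul, smul_mul', mul_comm (Φ (y g) f.2) (g • Φ (y h) f.2),
          ← mul_assoc]) rfl
      smul_mul := fun g f f' => Prod.ext (by
        change g • (f.1 * f'.1) * Φ (y g) (f.2 * f'.2) = (g • f.1 * Φ (y g) f.2) * (g • f'.1 * Φ (y g) f'.2)
        rw [smul_mul', map_mul, mul_mul_mul_comm]) rfl
      smul_one := fun g => Prod.ext (by
        change g • (1 : (PadicAlgCl p)ˣ) * Φ (y g) 1 = 1
        rw [smul_one, map_one, mul_one]) rfl }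
  -- torsion: members of `Λ(Fn)` have trivial `ℚ`-components
  have snd_eq_one : ∀ (ζ : cyclotome ((PadicAlgCl p)ˣ × Multiplicative ℚ)) (n : ℕ+),
      ((ζ : ℕ+ → (PadicAlgCl p)ˣ × Multiplicative ℚ) n).2 = 1 := by
    intro ζ n
    have h := congrArg Prod.snd (ζ.2.1 n)
    rw [Prod.pow_snd, Prod.snd_one] at h
    have h' : (n : ℕ) • Multiplicative.toAdd (((ζ : ℕ+ → (PadicAlgCl p)ˣ × Multiplicative ℚ) n).2) = 0 := by
      rw [← toAdd_pow, h, toAdd_one]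
    rcases (smul_eq_zero.mp h') with h0 | h0
    · exact absurd h0 n.ne_zero
    · have h1 : Multiplicative.ofAdd (Multiplicative.toAdd (((ζ : ℕ+ → (PadicAlgCl p)ˣ × Multiplicative ℚ) n).2)) =
          Multiplicative.ofAdd (0 : ℚ) := by rw [h0]
      rwa [ofAdd_toAdd, ofAdd_zero] at h1
  -- open stabilisers
  have hopenA : ∀ u : (PadicAlgCl p)ˣ, IsOpen (MulAction.stabilizer D.PiTemp u : Set D.PiTemp) := by
    intro u
    have h : (MulAction.stabilizer D.PiTemp u : Set D.PiTemp) =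
        D.aug ⁻¹' (MulAction.stabilizer (GQp p) u : Set (GQp p)) := by
      ext g; rfl
    rw [h]
    exact (isOpen_stabilizer_absoluteGaloisGroup_units ℚ_[p] u).preimage (map_continuous D.aug)
  have hopen : ∀ f : (PadicAlgCl p)ˣ × Multiplicative ℚ,
      IsOpen (MulAction.stabilizer D.PiTemp f : Set D.PiTemp) := by
    intro f
    obtain ⟨M, hM⟩ := Φ_triv f.2
    apply Subgroup.isOpen_of_one_mem_interior
    rw [mem_interior]
    refine ⟨(MulAction.stabilizer D.PiTemp f.1 : Set D.PiTemp) ∩ y ⁻¹' ((ZHatLevel.level M).ker : Set SettingModel.ZH),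
      fun g hg => ?_, (hopenA f.1).inter ((ZHatLevel.isOpen_ker_level M).preimage hy_cont), ?_⟩
    · obtain ⟨hg1, hg2⟩ := hg
      rw [SetLike.mem_coe, MulAction.mem_stabilizer_iff] at hg1 ⊢
      rw [Set.mem_preimage, SetLike.mem_coe, MonoidHom.mem_ker] at hg2
      rw [smul_def, hg1, hM _ hg2, mul_one]
    · refine ⟨?_, ?_⟩
      · rw [SetLike.mem_coe]; exact one_mem _
      · rw [Set.mem_preimage, SetLike.mem_coe, MonoidHom.mem_ker, hy_one, map_one]
  -- the constants `K̈ˣ → Fn`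
  let cst : (↥D.Kdd)ˣ →* (PadicAlgCl p)ˣ :=
    Units.map (algebraMap (↥D.Kdd) (PadicAlgCl p) : ↥D.Kdd →* PadicAlgCl p)
  have hcst : ∀ c, (cst c : PadicAlgCl p) = ((c : ↥D.Kdd) : PadicAlgCl p) := fun _ => rfl
  have hcst_fix : ∀ (c : (↥D.Kdd)ˣ) (h : D.PiTemp), h ∈ D.GtpYdd → h • cst c = cst c := by
    intro c h hh
    rw [hsmulA]
    exact KummerCore.smul_eq_of_coe_mem D.Kdd (cst c) (by rw [hcst]; exact (c : ↥D.Kdd).2) _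
      (C.aug_mem_fixingSubgroup_Kdd_of_mem_GtpYdd hh)
  let cstF : (↥D.Kdd)ˣ →* (PadicAlgCl p)ˣ × Multiplicative ℚ := (MonoidHom.inl _ _).comp cst
  have cstF_apply : ∀ c, cstF c = (cst c, 1) := fun _ => rfl
  have hcstF_mem : ∀ c, cstF c ∈ MulAction.fixedPoints D.GtpYdd ((PadicAlgCl p)ˣ × Multiplicative ℚ) := by
    intro c h
    show (h : D.PiTemp) • cstF c = cstF c
    rw [cstF_apply, smul_def, hcst_fix c h h.2, map_one, mul_one]
  -- the coefficients `Λ(Fn) = Λ(ℚ̄_pˣ) → Δ_Θ`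
  have cont_mapFst : Continuous (cyclotome.map
      (MonoidHom.fst (PadicAlgCl p)ˣ (Multiplicative ℚ)) :
        cyclotome ((PadicAlgCl p)ˣ × Multiplicative ℚ) → cyclotome (PadicAlgCl p)ˣ) :=
    continuous_induced_rng.2 (continuous_pi fun n =>
      continuous_fst.comp ((continuous_apply n).comp continuous_subtype_val))
  have mapFst_smul : ∀ (g : D.PiTemp) (ζ : cyclotome ((PadicAlgCl p)ˣ × Multiplicative ℚ)),
      cyclotome.map (MonoidHom.fst _ _) (g • ζ) = (C.augTheta (D.toTheta g)) • cyclotome.map (MonoidHom.fst _ _) ζ := by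
    intro g ζ
    apply Subtype.ext
    funext n
    show (g • (ζ : ℕ+ → (PadicAlgCl p)ˣ × Multiplicative ℚ) n).1 =
      (C.augTheta (D.toTheta g)) • ((ζ : ℕ+ → (PadicAlgCl p)ˣ × Multiplicative ℚ) n).1
    rw [smul_def, snd_eq_one, map_one, mul_one, hsmulA, C.augTheta_toTheta]
    rfl
  let coeffT : CyclotomeCoefficients D.toTheta D.DeltaTheta ((PadicAlgCl p)ˣ × Multiplicative ℚ) :=
    { hom := C.coeffHom.comp (cyclotome.map (MonoidHom.fst _ _))
      continuous_hom := C.continuous_coeffHom.comp cont_mapFst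
      hom_smul := fun g ζ => by
        rw [MonoidHom.comp_apply, MonoidHom.comp_apply, mapFst_smul]
        exact C.coeffHom_smul (D.toTheta g) _ }
  -- the roots of `Θ̈ := (1, 1)`
  let thetaF : (PadicAlgCl p)ˣ × Multiplicative ℚ := (1, Multiplicative.ofAdd 1)
  let thetaRootsF : RootSystem thetaF :=
    { root := fun n => (1, Multiplicative.ofAdd ((1 : ℚ) / (n : ℕ)))
      root_one := by simp [thetaF]
      root_mul_pow := fun n m => by
        refine Prod.ext (by simp) ?_
        rw [Prod.pow_snd, ← ofAdd_nsmul, nsmul_eq_mul, PNat.mul_coe, Nat.cast_mul]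
        congr 1
        have hn : ((n : ℕ) : ℚ) ≠ 0 := Nat.cast_ne_zero.2 n.ne_zero
        have hm : ((m : ℕ) : ℚ) ≠ 0 := Nat.cast_ne_zero.2 m.ne_zero
        field_simp }
  have theta_mem : thetaF ∈ MulAction.fixedPoints D.GtpYdd ((PadicAlgCl p)ˣ × Multiplicative ℚ) := by
    intro h
    show (h : D.PiTemp) • thetaF = thetaF
    rw [smul_def, smul_one, one_mul, Φ_at_one_of_even _ (hy_even h h.2)]
  -- the input
  let T : D.ThetaKummerInput :=
    { Fn := (PadicAlgCl p)ˣ × Multiplicative ℚ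
      isOpen_stabilizer := hopen
      theta := thetaF
      theta_mem := theta_mem
      thetaRoots := thetaRootsF
      const := cstF
      const_mem := hcstF_mem
      constRoots := fun c =>
        ((RootSystem.ofRootableBy (cst c)).map (MonoidHom.inl (PadicAlgCl p)ˣ (Multiplicative ℚ))).cast
          (rfl : _ = cstF c)
      coeff := coeffT }
  refine ⟨T, ?_, ?_, ?_⟩
  · -- bijective coefficients: `map fst : Λ(Fn) → Λ(ℚ̄_pˣ)` is a bijection
    refine C.bijective_coeffHom.comp ⟨fun ζ ζ' h => ?_, fun ζ₀ => ⟨cyclotome.map (MonoidHom.inl _ _) ζ₀, ?_⟩⟩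
    · apply Subtype.ext
      funext n
      have h1 := congrArg (fun ξ : cyclotome (PadicAlgCl p)ˣ => (ξ : ℕ+ → (PadicAlgCl p)ˣ) n) h
      simp only [cyclotome.map_apply, MonoidHom.coe_fst] at h1
      exact Prod.ext h1 (by rw [snd_eq_one, snd_eq_one])
    · exact Subtype.ext (funext fun n => rfl)
  · -- `ConstCompat`: the bridge's Kummer class of a constant IS the core's inflated class (same cocycle)
    intro c
    letI := D.unitsAction C.augTheta
    show D.inflTheta D.GtpYdd
        (C.coeff.kummerContMap (D.GtpYdd.map D.toTheta) C.isOpen_stabilizer' (C.toInvYdd c)) =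
      T.coeff.kummerContClass D.GtpYdd (T.constRoots c) (T.const_mem c) fun _ => T.isOpen_stabilizer _
    rw [C.coeff.kummerContMap_apply_eq (D.GtpYdd.map D.toTheta) C.isOpen_stabilizer' (C.toInvYdd c)
      (RootSystem.ofRootableBy ((C.toInvYdd c : C.invYdd) : (PadicAlgCl p)ˣ))]
    show ContH1.infl D.DeltaTheta D.toTheta D.continuous_toTheta le_rfl (ContH1.mk _ _) = ContH1.mk _ _
    refine ContH1.mk_congr D.GtpYdd ?_ _ _
    funext h
    show C.coeffHom ((RootSystem.ofRootableBy ((C.toInvYdd c : C.invYdd) : (PadicAlgCl p)ˣ)).kummerCocycle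
        (C.toInvYdd c).2 ⟨D.toTheta h.1, ⟨h.1, h.2, rfl⟩⟩) =
      C.coeffHom (cyclotome.map (MonoidHom.fst _ _)
        ((((RootSystem.ofRootableBy (cst c)).map (MonoidHom.inl (PadicAlgCl p)ˣ (Multiplicative ℚ))).cast
          (rfl : _ = cstF c)).kummerCocycle (hcstF_mem c) h))
    congr 1
    apply Subtype.ext
    funext n
    rw [cyclotome.map_apply, RootSystem.kummerCocycle_apply, RootSystem.kummerCocycle_apply, RootSystem.cast_root,
      RootSystem.map_root, MonoidHom.coe_fst]
    show (C.augTheta (D.toTheta h.1)) • (RootSystem.ofRootableBy (cst c)).root n /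
        (RootSystem.ofRootableBy (cst c)).root n =
      ((h : D.PiTemp) • (RootSystem.ofRootableBy (cst c)).root n * Φ (y (h : D.PiTemp)) 1) /
        (RootSystem.ofRootableBy (cst c)).root n
    rw [map_one, mul_one, hsmulA, C.augTheta_toTheta]
    rfl
  · -- the deck identity
    intro ε hε₁ hε₂
    show ε • thetaF = cstF (-1) * thetaF
    rw [smul_def, cstF_apply, smul_one, one_mul, Φ_at_one_of_odd _ (hy_odd ε hε₁ hε₂), Prod.mk_mul_mk, one_mul,
      mul_one]
    congr 1

end KummerCore

end ThetaSetting

/-! ### The instance at the χ-twisted root model -/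

namespace SettingModel

variable (p : ℕ) [Fact p.Prime]

/-- At `modelχ`, `Π^tp_Ÿ`-members have EVEN `y`-coordinate (`Δ^tp_{Y₂}`: `y ≡ 0 (2)`). [cite: MochizukiEtTh2009, §1 p.13] -/
theorem level_two_yCoordχ_eq_one_of_mem_GtpYdd {g : PiTpχ p} (hg : g ∈ (ThetaSetting.modelχ p).GtpYdd) :
    ZHatLevel.level 2 (yCoordχ p g) = 1 := by
  rw [GtpYdd_modelχ, mem_YNχ_two_iff] at hg
  obtain ⟨-, h2⟩ := Subgroup.mem_inf.mp hg
  obtain ⟨-, hy⟩ := Subgroup.mem_comap.mp h2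
  rw [← modN_eq_level]
  exact (hHat_y_eq_zero_iff 2 (gfpFst g.left)).mp hy

/-- At `modelχ`, a member of `Π^tp_Y ∖ Π^tp_Ÿ` has ODD `y`-coordinate. [cite: MochizukiEtTh2009, §1 p.13] -/
theorem level_two_yCoordχ_ne_one_of_not_mem_GtpYdd {g : PiTpχ p} (hY : g ∈ (ThetaSetting.modelχ p).GtpY)
    (hdd : g ∉ (ThetaSetting.modelχ p).GtpYdd) : ZHatLevel.level 2 (yCoordχ p g) ≠ 1 := by
  intro h
  apply hdd
  rw [GtpYdd_modelχ, mem_YNχ_two_iff]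
  have hker : g.left ∈ gfpSnd.ker := by
    rw [MonoidHom.mem_ker]; exact (mem_GtpY_modelχ_iff p g).mp hY
  refine Subgroup.mem_inf.mpr ⟨hker, Subgroup.mem_comap.mpr ⟨levelHom_x_eq_zero hker, ?_⟩⟩
  rw [← modN_eq_level] at h
  exact (hHat_y_eq_zero_iff 2 (gfpFst g.left)).mpr h

/-- **NON-VACUITY at `modelχ`: the deck identity `ε • Θ̈ = const(−1)·Θ̈` AND genuine constants (`ConstCompat kummerDataχ`,
bijective coefficients) are JOINTLY WITNESSED** by the `Ü`-monomial module over abc-iut-w5-d171's `kummerCoreχ` with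
`y := yCoordχ` (χ-crossed by `yCoordχ_mul`, continuous, parity by `Δ^tp_{Y₂}`). [cite: MochizukiEtTh2009, Prop 1.4 (ii) p.22] -/
theorem exists_thetaKummerInput_deck_modelχ :
    ∃ T : (ThetaSetting.modelχ p).ThetaKummerInput, letI := T.instAction
      Function.Bijective T.coeff.hom ∧ T.ConstCompat (kummerDataχ p) ∧
        ∀ ε : (ThetaSetting.modelχ p).PiTemp, ε ∈ (ThetaSetting.modelχ p).GtpY → ε ∉ (ThetaSetting.modelχ p).GtpYdd →
          ε • T.theta = T.const (-1) * T.theta :=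
  (kummerCoreχ p).exists_thetaKummerInput_deck_of_yCocycle (yCoordχ p) (fun g h => yCoordχ_mul p g h)
    (continuous_yCoordχ p) (fun _ hg => level_two_yCoordχ_eq_one_of_mem_GtpYdd p hg)
    (fun _ hY hdd => level_two_yCoordχ_ne_one_of_not_mem_GtpYdd p hY hdd)

/-- … and, by `ThetaKummerInversionFixedPoints` (F-w5d125g7-1), THIS VERY WITNESS admits NO function-level inversion package
for the inversion of record `twistedInversionTop (chi p) …` (its `κ(Θ̈)` is the `y`-class `log(Ü)`, which the inversion
negates — print p. 23): `hdeck` ✓ and genuine constants ✓ coexist with `¬∃ ιFn (hιFn ∧ hΛ ∧ hιθ)` at `modelχ`.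
[cite: MochizukiEtTh2009, Prop 1.5 (ii) p.23] -/
theorem exists_thetaKummerInput_deck_not_package_modelχ :
    ∃ T : (ThetaSetting.modelχ p).ThetaKummerInput, letI := T.instAction
      Function.Bijective T.coeff.hom ∧ T.ConstCompat (kummerDataχ p) ∧
      (∀ ε : (ThetaSetting.modelχ p).PiTemp, ε ∈ (ThetaSetting.modelχ p).GtpY → ε ∉ (ThetaSetting.modelχ p).GtpYdd →
        ε • T.theta = T.const (-1) * T.theta) ∧
      ¬ ∃ ιFn : T.Fn →* T.Fn,
        (∀ (g : (ThetaSetting.modelχ p).PiTemp) (f : T.Fn),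
          ιFn (g • f) = (twistedInversionTop (chi p) (isInducing_leftRightχ p) :
            (ThetaSetting.modelχ p).PiTemp ≃ₜ* (ThetaSetting.modelχ p).PiTemp) g • ιFn f) ∧
        (∀ ζ : cyclotome T.Fn, cyclotome.map ιFn ζ = ζ) ∧ ιFn T.theta = T.const (-1) * T.theta := by
  obtain ⟨T, hb, hcc, hdeck⟩ := exists_thetaKummerInput_deck_modelχ p
  exact ⟨T, hb, hcc, hdeck, not_exists_package_modelχ_of_constCompat p T hcc⟩

end SettingModel

end Literature.AnabelianGeometry.EtaleTheta
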